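import Summits.AtomisticToContinuum.BoseEinsteinCondensation.Theses.BECFeynmanVortexArea
import Literature.MathematicalPhysics.QuantumManyBody.SquareWellScatteringLength

/-!
# AtomisticToContinuum / BoseEinsteinCondensation — `BornRepresentativesExist`

Settles the shared support item `stmt-AtomisticToContinuum-9049` (`BornRepresentativesExist` of
route `BECFeynmanVortexArea`; verbatim also in `BECChargeConjugationRP` and
`BECEqualScatteringTransfer`): for every `ε > 0` and `a ≥ 0` there is a bounded, measurable,
finite-range radial profile `v` of some range `R > 0` in the Born window `v ≤ ε/R²` whose
variational scattering length is exactly `a`.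

Witness. For `a = 0` the free gas `v = 0` (`scatteringLength_zero`). For `a > 0` the finite
spherical well `v = K·1_{r ≤ R}` of height `K = ε/R²`: by the tree's
`scatteringLength_squareWell` (LSSY2005 App. C / FournaisEtAl2024 (3.9)) its scattering length is
`R - tanh(R√(K/2))/√(K/2) = R (1 - tanh Y / Y)` with `Y = R√(K/2) = √(ε/2)` independent of `R`,
so `R = a / (1 - tanh Y / Y)` does it; `1 - tanh Y / Y > 0` is `tanh Y < Y` for `Y > 0`.
-/

noncomputable section

open Set

namespace Summit.AtomisticToContinuum.BoseEinsteinCondensation.Theorems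

open Literature.MathematicalPhysics.QuantumManyBody.BoseGas

/-- `sinh y < y cosh y` for `y > 0`: the function `y cosh y - sinh y` vanishes at `0` and has
derivative `y sinh y > 0` on `(0, ∞)`. [folklore] -/
theorem sinh_lt_self_mul_cosh {y : ℝ} (hy : 0 < y) : Real.sinh y < y * Real.cosh y := by
  have hderiv : ∀ x : ℝ,
      HasDerivAt (fun y => y * Real.cosh y - Real.sinh y) (x * Real.sinh x) x := by
    intro x
    have h1 : HasDerivAt (fun y : ℝ => y * Real.cosh y) (1 * Real.cosh x + x * Real.sinh x) x :=
      (hasDerivAt_id x).mul (Real.hasDerivAt_cosh x)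
    exact (h1.sub (Real.hasDerivAt_sinh x)).congr_deriv (by ring)
  have hmono : StrictMonoOn (fun y => y * Real.cosh y - Real.sinh y) (Ici 0) := by
    refine strictMonoOn_of_deriv_pos (convex_Ici 0) ?_ ?_
    · exact ((continuous_id.mul Real.continuous_cosh).sub Real.continuous_sinh).continuousOn
    · intro x hx
      rw [interior_Ici] at hx
      rw [(hderiv x).deriv]
      exact mul_pos hx (Real.sinh_pos_iff.2 hx)
  have h := hmono (self_mem_Ici (a := (0 : ℝ))) (mem_Ici.2 hy.le) hy
  simp only [zero_mul, Real.sinh_zero, sub_zero] at h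
  linarith

/-- `tanh y < y` for `y > 0`. [folklore] -/
theorem tanh_lt_self {y : ℝ} (hy : 0 < y) : Real.tanh y < y := by
  rw [Real.tanh_eq_sinh_div_cosh, div_lt_iff₀ (Real.cosh_pos y)]
  exact sinh_lt_self_mul_cosh hy

/-- **Born-regime representatives of every scattering length** (explicit form of the shared item
`stmt-AtomisticToContinuum-9049`): for `ε > 0` and `a ≥ 0` there is a measurable finite-range
`v : ℝ → [0, ∞]`, bounded, of some range `R > 0` with `v ≤ ε/R²`, and `scatteringLength v = a`.
Witness: `v = 0` if `a = 0`; otherwise the well of radius `R = a/(1 - tanh Y/Y)`, `Y = √(ε/2)`,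
and height `ε/R²`, whose scattering length is `R(1 - tanh Y/Y) = a` by
`scatteringLength_squareWell`. [cite: LSSY2005, App. C, Thm. C.1] -/
theorem exists_bornRepresentative {ε : ℝ} (hε : 0 < ε) {a : ℝ} (ha : 0 ≤ a) :
    ∃ v : ℝ → ENNReal, IsRepulsiveFiniteRange v ∧ (∃ M : NNReal, ∀ r, v r ≤ M) ∧
      (∃ R : ℝ, 0 < R ∧ (∀ r, R < r → v r = 0) ∧ ∀ r, v r ≤ ENNReal.ofReal (ε / R ^ 2)) ∧
      scatteringLength v = ENNReal.ofReal a := by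
  rcases ha.eq_or_lt with rfl | ha0
  · -- the free gas
    refine ⟨0, ⟨measurable_const, 0, fun r _ => rfl⟩, ⟨0, fun r => ?_⟩,
      ⟨1, one_pos, fun r _ => rfl, fun r => ?_⟩, ?_⟩
    · simp
    · simp
    · rw [scatteringLength_zero, ENNReal.ofReal_zero]
  · -- the finite well of radius `R = a / (1 - tanh Y / Y)` and height `ε / R²`
    set Y : ℝ := Real.sqrt (ε / 2) with hY
    have hY0 : 0 < Y := Real.sqrt_pos.2 (by positivity)
    set t : ℝ := 1 - Real.tanh Y / Y with ht
    have ht0 : 0 < t := by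
      have h := tanh_lt_self hY0
      rw [ht, sub_pos, div_lt_one hY0]
      exact h
    set R : ℝ := a / t with hR
    have hR0 : 0 < R := div_pos ha0 ht0
    set K : ℝ := ε / R ^ 2 with hK
    have hK0 : 0 < K := by positivity
    refine ⟨(Set.Iic R).indicator fun _ : ℝ => ENNReal.ofReal K,
      ⟨measurable_squareWell K R, R, fun r hr => squareWell_eq_zero hr⟩,
      ⟨Real.toNNReal K, fun r => squareWell_le K R r⟩,
      ⟨R, hR0, fun r hr => squareWell_eq_zero hr, fun r => squareWell_le K R r⟩, ?_⟩
    rw [scatteringLength_squareWell hK0 hR0]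
    congr 1
    have hY2 : Y ^ 2 = ε / 2 := Real.sq_sqrt (by positivity)
    have hK2 : K / 2 = (Y / R) ^ 2 := by
      rw [div_pow, hY2, hK]
      field_simp
    have hc : Real.sqrt (K / 2) = Y / R := by
      rw [hK2, Real.sqrt_sq (by positivity)]
    have haR : a = R * t := by
      rw [hR, div_mul_cancel₀ a ht0.ne']
    rw [hc, div_mul_cancel₀ Y hR0.ne', haR, ht]
    field_simp

/-- Settles `stmt-AtomisticToContinuum-9049` (exact signature): the support
`BornRepresentativesExist` of route `BECFeynmanVortexArea`. [cite: LSSY2005, App. C, Thm. C.1] -/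
theorem bornRepresentativesExist_proof :
    Summit.AtomisticToContinuum.BoseEinsteinCondensation.Theses.BECFeynmanVortexArea.BornRepresentativesExist := by
  unfold Theses.BECFeynmanVortexArea.BornRepresentativesExist
  intro ε hε a ha
  exact exists_bornRepresentative hε ha

end Summit.AtomisticToContinuum.BoseEinsteinCondensation.Theorems

end
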